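import Summits.QuantumFields.YangMills.Theorems.PoincareLipschitzTwoSidedOfConcentrationStep

/-!
# Crux `HistoryTailL` (stmt-QuantumFields-19936), line #12 — THE p-LINEAR GLUE (A′1): THE ONE-HEIGHT STEP FROM AN EXPONENTIAL
# (Poincaré ∕ spectral-gap class) CONCENTRATION HYPOTHESIS

Cell `ym3-torus` (YM ladder rung R3 = continuum SU(2) Yang–Mills on the 3-torus — NOT d = 4, NOT infinite volume, NOT a mass gap, NOT the Clay
problem), width seat `ym-ust-19936-w4` gen 12; `--supports stmt-QuantumFields-19936 --as helper`.  Companion of the located memo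
`K1-MESOSCOPIC-LOCATE-w4g12.md` (19936 evidence #46) §2 and of `…PoincareLipschitzHistoryTailOfLinearTail` (B′).

★`local_step_lin` is ✓`PoincareLipschitz.TwoSidedOfConcentration.local_step` (route PoincareLipschitz glue, helper 5) with its concentration
hypothesis `hK1` in the EXPONENTIAL shape `Cc·exp(−cc·√β_K·r∕(n·Λ))` — what a spectral gap `≥ cc²·β_K∕n²` for the cut-off Gibbs law on box-local
gauge-invariant observables gives by Gromov–Milman ∕ Aida–Masuda–Shigekawa, and which the Gaussian shape of the registered crux
`MesoscopicConcentrationL` implies (`e^{−cc·s²} ≤ e^{cc∕4}·e^{−cc·s}`) — and, accordingly, the p-LINEAR conclusion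
`Gibbs_K({θ ≤ f_a} ∩ G(a,j)) ≤ Cc·exp(−(cc∕(68(CL+1)))·p(g_{K−j}))`.  The proof is the landed one VERBATIM (capped McShane extension in the box link
pseudometric ✓`exists_capped_infConvolution`, mean `≤ ¾θ`, the event inside `{θ∕4 ≤ g − E g}`, the box `n = 17L^j`), followed by the p-linear
exponent bookkeeping `cc·√β_K·(θ∕4)∕(17L^j·(CL+1)∕√L^j) = cc·p∕(68(CL+1))` from `√β_K·θ(K−j) = √(L^j)·p(g_{K−j})` (✓`beta_mul_θBal_sq`).
[adapted from ✓`PoincareLipschitzTwoSidedOfConcentrationStep.local_step` (ym-line-sfw-p2-w3 g30), cited, not modified]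

HONEST: a conditional step (route glue); nothing of K1 (in either shape), K2, the cruxes, rung R3 or the mass gap is proved.  THEOREMS ONLY,
definition-free. [cite: Balaban1985UV3, (3) p.256 and (7) p.257]
-/

set_option autoImplicit false

namespace Summit.QuantumFields.YangMills.Theorems.PoincareLipschitzLinear

open MeasureTheory
open scoped BigOperators
open Literature.MathematicalPhysics.QuantumFieldTheory.Balaban1983to89
open Literature.MathematicalPhysics.QuantumFieldTheory.Balaban1983to89.T3ContinuumYM3Torus
open Literature.MathematicalPhysics.QuantumFieldTheory.Balaban1983to89.T3UnitScaleTilt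
open Literature.MathematicalPhysics.QuantumFieldTheory.Balaban1983to89.T3UnitLawDensityEML (ℰp measurableE_ℰp)
open Literature.MathematicalPhysics.QuantumFieldTheory.Balaban1983to89.T3OrbitAverage
open Literature.MathematicalPhysics.QuantumFieldTheory.Balaban1983to89.T3MinimiserStabilityReduction (θBal_pos)
open Literature.MathematicalPhysics.QuantumFieldTheory.Balaban1983to89.T3FinestHeightTail (beta_mul_θBal_sq)
open Literature.MathematicalPhysics.QuantumFieldTheory.Balaban1983to89.T4PairDerivBridge (dist1_le_two_specialUnitaryGroup)
open Summit.QuantumFields.YangMills.Theorems.PoincareLipschitz.TwoSidedOfConcentration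

/-- ★ **THE ONE-HEIGHT STEP, p-LINEAR.**  As ✓`local_step`, with the concentration hypothesis in the exponential (Poincaré-class) shape
`Gibbs_K{r ≤ f − ∫f} ≤ Cc·exp(−cc·√β_K·r∕(n·Λ))` for box-local gauge-invariant `Λ`-Lipschitz `f`, and the conclusion
`Gibbs_K({θ(K−j) ≤ f_a} ∩ G(a,j)) ≤ Cc·exp(−(cc∕(68(CL+1)))·p(g_{K−j}))` — exponent LINEAR in `p`. [cite: Balaban1985UV3, (3) p.256 and (7) p.257] -/
theorem local_step_lin (F : T3Family) {γ b₀ p₀ : ℝ} (hγ : 0 < γ) (hγ2 : γ ≤ 1 / 2) (hb₀ : 0 < b₀)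
    {K j : ℕ} (hjK : j + 2 ≤ K) (a : Plaq (F.P K) j) {Cc cc CL : ℝ} (hCL : 0 ≤ CL)
    (hK1 : ∀ (n : ℕ), 1 ≤ n → (n : ℝ) ≤ (F.scheme ℰp γ).β K → 2 * n ≤ (F.P K).sitesPerDir 0 →
      ∀ (x₀ : Site (F.P K) 0) (f : GaugeField (F.P K) 0 (Matrix.specialUnitaryGroup (Fin 2) ℂ) → ℝ) (Λ : ℝ), 0 < Λ → Measurable f → GaugeField.GaugeInvariant f →
      (∀ U U' : GaugeField (F.P K) 0 (Matrix.specialUnitaryGroup (Fin 2) ℂ), (∀ b : PBond (F.P K) 0, (∀ k, (b.src k - x₀ k).val < n) → (∀ k, (b.tgt k - x₀ k).val < n) → U b = U' b) →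
        f U = f U') →
      (∀ U U' : GaugeField (F.P K) 0 (Matrix.specialUnitaryGroup (Fin 2) ℂ), |f U - f U'| ≤ Λ * Real.sqrt (∑ b : PBond (F.P K) 0, GaugeGroup.dist1 (U b * (U' b)⁻¹) ^ 2)) →
      ∀ r : ℝ, 0 ≤ r → (gibbsK F ℰp γ K).real {U | r ≤ f U - ∫ V, f V ∂(gibbsK F ℰp γ K)} ≤
        Cc * Real.exp (-(cc * Real.sqrt ((F.scheme ℰp γ).β K) * r / ((n : ℝ) * Λ))))
    (hK2 : ∀ U U' : GaugeField (F.P K) 0 (Matrix.specialUnitaryGroup (Fin 2) ℂ), (∀ (i : ℕ) (q : Plaq (F.P K) i), i < j → Site.tdist (fun k => ((((q.src k).val * F.L ^ i : ℕ)) : ZMod ((F.P K).sitesPerDir 0))) (fun k => ((((a.src k).val * F.L ^ j : ℕ)) : ZMod ((F.P K).sitesPerDir 0))) + 64 * F.L ^ i ≤ 64 * F.L ^ j → GaugeGroup.dist1 (GaugeField.plaqHol (Averaging.iter (fun i' => BlockAveraging.blockAvg (P := F.P K) (j := i') ℰp) i U) q) < θBal F.L γ b₀ p₀ (K - i)) →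 (∀ (i : ℕ) (q : Plaq (F.P K) i), i < j → Site.tdist (fun k => ((((q.src k).val * F.L ^ i : ℕ)) : ZMod ((F.P K).sitesPerDir 0))) (fun k => ((((a.src k).val * F.L ^ j : ℕ)) : ZMod ((F.P K).sitesPerDir 0))) + 64 * F.L ^ i ≤ 64 * F.L ^ j → GaugeGroup.dist1 (GaugeField.plaqHol (Averaging.iter (fun i' => BlockAveraging.blockAvg (P := F.P K) (j := i') ℰp) i U') q) < θBal F.L γ b₀ p₀ (K - i)) →
      |GaugeGroup.dist1 (GaugeField.plaqHol (Averaging.iter (fun i' => BlockAveraging.blockAvg (P := F.P K) (j := i') ℰp) j U) a) - GaugeGroup.dist1 (GaugeField.plaqHol (Averaging.iter (fun i' => BlockAveraging.blockAvg (P := F.P K) (j := i') ℰp) j U') a)| ≤ CL / Real.sqrt ((F.L : ℝ) ^ j) * Real.sqrt (∑ b : PBond (F.P K) 0, if (∀ k, (b.src k - ((((a.src k).val * F.L ^ j : ℕ)) : ZMod ((F.P K).sitesPerDir 0)) + ((8 * F.L ^ j : ℕ) : ZMod ((F.P K).sitesPerDir 0))).val < 17 * F.L ^ j) ∧ (∀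 k, (b.tgt k - ((((a.src k).val * F.L ^ j : ℕ)) : ZMod ((F.P K).sitesPerDir 0)) + ((8 * F.L ^ j : ℕ) : ZMod ((F.P K).sitesPerDir 0))).val < 17 * F.L ^ j) then GaugeGroup.dist1 (U b * (U' b)⁻¹) ^ 2 else 0))
    (hMean : ∫ U, GaugeGroup.dist1 (GaugeField.plaqHol (Averaging.iter (fun i' => BlockAveraging.blockAvg (P := F.P K) (j := i') ℰp) j U) a) ∂(gibbsK F ℰp γ K) ≤ θBal F.L γ b₀ p₀ (K - j) / 2)
    (hGc : (gibbsK F ℰp γ K).real {U : GaugeField (F.P K) 0 (Matrix.specialUnitaryGroup (Fin 2) ℂ) | (∀ (i : ℕ) (q : Plaq (F.P K) i), i < j → Site.tdist (fun k => ((((q.src k).val * F.L ^ i : ℕ)) : ZMod ((F.P K).sitesPerDir 0))) (fun k => ((((a.src k).val * F.L ^ j : ℕ)) : ZMod ((F.P K).sitesPerDir 0))) + 64 * F.L ^ i ≤ 64 * F.L ^ j → GaugeGroup.dist1 (GaugeField.plaqHol (Averaging.iter (fun i' => BlockAveraging.blockAvg (P := F.P K) (j := i') ℰp) i U) q) < θBal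 F.L γ b₀ p₀ (K - i))}ᶜ ≤ 1 / 4) :
    (gibbsK F ℰp γ K).real ({U : GaugeField (F.P K) 0 (Matrix.specialUnitaryGroup (Fin 2) ℂ) | θBal F.L γ b₀ p₀ (K - j) ≤ GaugeGroup.dist1 (GaugeField.plaqHol (Averaging.iter (fun i' => BlockAveraging.blockAvg (P := F.P K) (j := i') ℰp) j U) a)} ∩ {U : GaugeField (F.P K) 0 (Matrix.specialUnitaryGroup (Fin 2) ℂ) | (∀ (i : ℕ) (q : Plaq (F.P K) i), i < j → Site.tdist (fun k => ((((q.src k).val * F.L ^ i : ℕ)) : ZMod ((F.P K).sitesPerDir 0))) (fun k => ((((a.src k).val * F.L ^ j : ℕ)) : ZMod ((F.P K).sitesPerDir 0))) + 64 * F.L ^ i ≤ 64 * F.L ^ j → GaugeGroup.dist1 (GaugeField.plaqHol (Averaging.iter (fun i' => BlockAveraging.blockAvg (P := F.P K) (j := i') ℰp) i U) q) < θBal F.L γ b₀ p₀ (K - i))}) ≤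
      Cc * Real.exp (-(cc / (68 * (CL + 1)) * B10.pFun b₀ p₀ (Real.sqrt (γ * ((F.L : ℝ)⁻¹) ^ (K - j))))) := by
  haveI := isProbabilityMeasure_gibbsK F ℰp hγ.le K
  have hγ1 : γ ≤ 1 := by linarith
  have hL1 : 1 ≤ F.L := F.hL.2.le
  have hL3 : 3 ≤ F.L := by obtain ⟨k, hk⟩ := F.hL.1; have := F.hL.2; omega
  have hLr : (3 : ℝ) ≤ F.L := by exact_mod_cast hL3
  set μ := gibbsK F ℰp γ K with hμ
  set θ := θBal F.L γ b₀ p₀ (K - j) with hθ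
  have hθpos : 0 < θ := θBal_pos hL1 hγ hγ1 hb₀ p₀ (K - j)
  have hLj : (0 : ℝ) < (F.L : ℝ) ^ j := by positivity
  have hsq : 0 < Real.sqrt ((F.L : ℝ) ^ j) := Real.sqrt_pos.mpr hLj
  set Λ : ℝ := (CL + 1) / Real.sqrt ((F.L : ℝ) ^ j) with hΛ
  have hΛpos : 0 < Λ := div_pos (by linarith) hsq
  set f : GaugeField (F.P K) 0 (Matrix.specialUnitaryGroup (Fin 2) ℂ) → ℝ := fun U => GaugeGroup.dist1 (GaugeField.plaqHol (Averaging.iter (fun i' => BlockAveraging.blockAvg (P := F.P K) (j := i') ℰp) j U) a) with hf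
  set G : Set (GaugeField (F.P K) 0 (Matrix.specialUnitaryGroup (Fin 2) ℂ)) := {U : GaugeField (F.P K) 0 (Matrix.specialUnitaryGroup (Fin 2) ℂ) | (∀ (i : ℕ) (q : Plaq (F.P K) i), i < j → Site.tdist (fun k => ((((q.src k).val * F.L ^ i : ℕ)) : ZMod ((F.P K).sitesPerDir 0))) (fun k => ((((a.src k).val * F.L ^ j : ℕ)) : ZMod ((F.P K).sitesPerDir 0))) + 64 * F.L ^ i ≤ 64 * F.L ^ j → GaugeGroup.dist1 (GaugeField.plaqHol (Averaging.iter (fun i' => BlockAveraging.blockAvg (P := F.P K) (j := i') ℰp) i U) q) < θBal F.L γ b₀ p₀ (K - i))} with hG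
  set d : GaugeField (F.P K) 0 (Matrix.specialUnitaryGroup (Fin 2) ℂ) → GaugeField (F.P K) 0 (Matrix.specialUnitaryGroup (Fin 2) ℂ) → ℝ := fun U U' => Real.sqrt (∑ b : PBond (F.P K) 0, if (∀ k, (b.src k - ((((a.src k).val * F.L ^ j : ℕ)) : ZMod ((F.P K).sitesPerDir 0)) + ((8 * F.L ^ j : ℕ) : ZMod ((F.P K).sitesPerDir 0))).val < 17 * F.L ^ j) ∧ (∀ k, (b.tgt k - ((((a.src k).val * F.L ^ j : ℕ)) : ZMod ((F.P K).sitesPerDir 0)) + ((8 * F.L ^ j : ℕ) : ZMod ((F.P K).sitesPerDir 0))).val < 17 * F.L ^ j) then GaugeGroup.dist1 (U b * (U' b)⁻¹) ^ 2 else 0) with hd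
  -- §1 the McShane extension
  obtain ⟨g, hg0, hgθ, hgf, hgeq, hgLip, hginv, hgloc, hgmeas⟩ :=
    exists_capped_infConvolution d (fun U U' => boxLinkDist_nonneg _ U U') (fun U => boxLinkDist_self _ U)
      (fun U U' => boxLinkDist_comm _ U U') (fun U U' U'' => boxLinkDist_triangle _ U U' U'')
      (fun U' => continuous_boxLinkDist _ U') G f (fun U => GaugeGroup.dist1_nonneg _) θ Λ hθpos.le hΛpos.le
      (fun U hU U' hU' => (hK2 U U' hU hU').trans
        (mul_le_mul_of_nonneg_right (div_le_div_of_nonneg_right (by linarith) hsq.le) (Real.sqrt_nonneg _)))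
      (GaugeField.gaugeAct (P := F.P K) (j := 0) (G := (Matrix.specialUnitaryGroup (Fin 2) ℂ)))
      (fun u U hU => by
        simp only [hG, Set.mem_setOf_eq] at hU ⊢
        intro i q hi hnear
        rw [dist1_plaqHol_iter_gaugeAct F (by omega) q u U]
        exact hU i q hi hnear)
      (fun u U => by simp only [hf]; exact dist1_plaqHol_iter_gaugeAct F (by omega) a u U)
      (fun u U U' => boxLinkDist_gaugeAct _ u U U')
      (fun u => ⟨fun x => (u x)⁻¹, gaugeAct_gaugeAct_inv u⟩)
      (fun U U' => ∀ b : PBond (F.P K) 0, (∀ k, (b.src k - ((((a.src k).val * F.L ^ j : ℕ)) : ZMod ((F.P K).sitesPerDir 0)) + ((8 * F.L ^ j : ℕ) : ZMod ((F.P K).sitesPerDir 0))).val < 17 * F.L ^ j) ∧ (∀ k, (b.tgt k - ((((a.src k).val * F.L ^ j : ℕ)) : ZMod ((F.P K).sitesPerDir 0)) + ((8 * F.L ^ j : ℕ) : ZMod ((F.P K).sitesPerDir 0))).val < 17 * F.L ^ j) → U b = U' b)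
      (fun U U' h V => boxLinkDist_congr_left _ h V)
  -- §2 integrability and the mean of `g`
  have hmeas : ∀ (i : ℕ) (q : Plaq (F.P K) i), Measurable fun U : GaugeField (F.P K) 0 (Matrix.specialUnitaryGroup (Fin 2) ℂ) =>
      GaugeGroup.dist1 (GaugeField.plaqHol (Averaging.iter (fun i' => BlockAveraging.blockAvg (P := F.P K) (j := i') ℰp) i U) q) :=
    fun i q => RegularGaugeGroup.measurable_dist1.comp ((Missing.measurable_plaqHol q).comp
      (T4Continuum.measurable_iter _ (F.avgMeasurable_of_measurableE ℰp measurableE_ℰp K) i))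
  have hf_meas : Measurable f := hmeas j a
  have hf_int : Integrable f μ :=
    Integrable.mono' (integrable_const (2 : ℝ)) hf_meas.aestronglyMeasurable
      (ae_of_all _ fun U => by
        rw [Real.norm_eq_abs, abs_of_nonneg (GaugeGroup.dist1_nonneg _)]
        exact dist1_le_two_specialUnitaryGroup _)
  have hg_int : Integrable g μ :=
    Integrable.mono' (integrable_const θ) hgmeas.aestronglyMeasurable
      (ae_of_all _ fun U => by rw [Real.norm_eq_abs, abs_of_nonneg (hg0 U)]; exact hgθ U)
  have hG_meas : MeasurableSet G := by
    have hGeq : G = ⋂ (i : ℕ), ⋂ (q : Plaq (F.P K) i),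
        {U : GaugeField (F.P K) 0 (Matrix.specialUnitaryGroup (Fin 2) ℂ) | i < j → Site.tdist (fun k => ((((q.src k).val * F.L ^ i : ℕ)) : ZMod ((F.P K).sitesPerDir 0))) (fun k => ((((a.src k).val * F.L ^ j : ℕ)) : ZMod ((F.P K).sitesPerDir 0))) + 64 * F.L ^ i ≤ 64 * F.L ^ j → GaugeGroup.dist1 (GaugeField.plaqHol (Averaging.iter (fun i' => BlockAveraging.blockAvg (P := F.P K) (j := i') ℰp) i U) q) < θBal F.L γ b₀ p₀ (K - i)} := by
      ext U
      simp only [hG, Set.mem_setOf_eq, Set.mem_iInter]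
    rw [hGeq]
    refine MeasurableSet.iInter fun i => MeasurableSet.iInter fun q => ?_
    by_cases hc : i < j ∧ Site.tdist (fun k => ((((q.src k).val * F.L ^ i : ℕ)) : ZMod ((F.P K).sitesPerDir 0))) (fun k => ((((a.src k).val * F.L ^ j : ℕ)) : ZMod ((F.P K).sitesPerDir 0))) + 64 * F.L ^ i ≤ 64 * F.L ^ j
    · have hset : {U : GaugeField (F.P K) 0 (Matrix.specialUnitaryGroup (Fin 2) ℂ) | i < j → Site.tdist (fun k => ((((q.src k).val * F.L ^ i : ℕ)) : ZMod ((F.P K).sitesPerDir 0))) (fun k => ((((a.src k).val * F.L ^ j : ℕ)) : ZMod ((F.P K).sitesPerDir 0))) + 64 * F.L ^ i ≤ 64 * F.L ^ j → GaugeGroup.dist1 (GaugeField.plaqHol (Averaging.iter (fun i' => BlockAveraging.blockAvg (P := F.P K) (j := i') ℰp) i U) q) < θBal F.L γ b₀ p₀ (K - i)} =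
          {U : GaugeField (F.P K) 0 (Matrix.specialUnitaryGroup (Fin 2) ℂ) | GaugeGroup.dist1 (GaugeField.plaqHol (Averaging.iter (fun i' => BlockAveraging.blockAvg (P := F.P K) (j := i') ℰp) i U) q) < θBal F.L γ b₀ p₀ (K - i)} := by
        ext U
        simp only [Set.mem_setOf_eq]
        exact ⟨fun h => h hc.1 hc.2, fun h _ _ => h⟩
      rw [hset]
      exact measurableSet_lt (hmeas i q) measurable_const
    · have hset : {U : GaugeField (F.P K) 0 (Matrix.specialUnitaryGroup (Fin 2) ℂ) | i < j → Site.tdist (fun k => ((((q.src k).val * F.L ^ i : ℕ)) : ZMod ((F.P K).sitesPerDir 0))) (fun k => ((((a.src k).val * F.L ^ j : ℕ)) : ZMod ((F.P K).sitesPerDir 0))) + 64 * F.L ^ i ≤ 64 * F.L ^ j → GaugeGroup.dist1 (GaugeField.plaqHol (Averaging.iter (fun i' => BlockAveraging.blockAvg (P := F.P K) (j := i') ℰp) i U) q) < θBal F.L γ b₀ p₀ (K - i)} = Set.univ := by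
        ext U
        simp only [Set.mem_setOf_eq, Set.mem_univ, iff_true]
        intro h1 h2
        exact absurd ⟨h1, h2⟩ hc
      rw [hset]
      exact MeasurableSet.univ
  have hpt : ∀ U, g U ≤ f U + Gᶜ.indicator (fun _ => θ) U := by
    intro U
    by_cases hU : U ∈ G
    · rw [Set.indicator_of_notMem (Set.notMem_compl_iff.mpr hU), add_zero]
      exact hgf U hU
    · rw [Set.indicator_of_mem (Set.mem_compl hU)]
      have := hgθ U
      have := GaugeGroup.dist1_nonneg (GaugeField.plaqHol (Averaging.iter (fun i' => BlockAveraging.blockAvg (P := F.P K) (j := i') ℰp) j U) a)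
      simp only [hf]
      linarith
  have hint_g : ∫ U, g U ∂μ ≤ θ / 2 + θ * (1 / 4) := by
    have hind : Integrable (Gᶜ.indicator fun _ : GaugeField (F.P K) 0 (Matrix.specialUnitaryGroup (Fin 2) ℂ) => θ) μ := (integrable_const θ).indicator hG_meas.compl
    calc ∫ U, g U ∂μ ≤ ∫ U, (f U + Gᶜ.indicator (fun _ => θ) U) ∂μ := integral_mono hg_int (hf_int.add hind) hpt
      _ = ∫ U, f U ∂μ + ∫ U, Gᶜ.indicator (fun _ => θ) U ∂μ := integral_add hf_int hind
      _ = ∫ U, f U ∂μ + μ.real Gᶜ * θ := by rw [integral_indicator_const θ hG_meas.compl, smul_eq_mul]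
      _ ≤ θ / 2 + 1 / 4 * θ := by
          have h1 : ∫ U, f U ∂μ ≤ θ / 2 := hMean
          have h2 : μ.real Gᶜ * θ ≤ 1 / 4 * θ := mul_le_mul_of_nonneg_right hGc hθpos.le
          linarith
      _ = θ / 2 + θ * (1 / 4) := by ring
  -- §3 the event sits in the upper tail of `g`
  have hsub : ({U : GaugeField (F.P K) 0 (Matrix.specialUnitaryGroup (Fin 2) ℂ) | θ ≤ f U} ∩ G) ⊆ {U | θ / 4 ≤ g U - ∫ V, g V ∂μ} := by
    rintro U ⟨hU1, hU2⟩
    simp only [Set.mem_setOf_eq] at hU1 ⊢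
    rw [hgeq U hU2 hU1]
    linarith
  -- §4 the box: side `n = 17 L^j`, corner `corner(a) L^j − 8 L^j`
  have h1n : 1 ≤ 17 * F.L ^ j := by
    have : 1 ≤ F.L ^ j := Nat.one_le_pow _ _ (by omega)
    omega
  have h2n : 2 * (17 * F.L ^ j) ≤ (F.P K).sitesPerDir 0 := by
    have hN0 : (F.P K).sitesPerDir 0 = 2 * F.L ^ (F.m + K) := by simp [Params.sitesPerDir]
    rw [hN0]
    have hsplit : F.L ^ (F.m + K) = F.L ^ j * F.L ^ (F.m + K - j) := by rw [← pow_add]; congr 1; omega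
    have h27 : 27 ≤ F.L ^ (F.m + K - j) :=
      calc 27 = 3 ^ 3 := by norm_num
        _ ≤ F.L ^ 3 := Nat.pow_le_pow_left hL3 3
        _ ≤ F.L ^ (F.m + K - j) := Nat.pow_le_pow_right (by omega) (by have := F.hm; omega)
    rw [hsplit]
    nlinarith
  have hβK : (F.scheme ℰp γ).β K = (F.L : ℝ) ^ K / γ := by
    show (γ * (F.P K).eps)⁻¹ = _
    have heps : (F.P K).eps = ((F.L : ℝ)⁻¹) ^ K := rfl
    rw [heps, mul_inv, inv_pow, inv_inv, div_eq_inv_mul]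
  have hnβ : ((17 * F.L ^ j : ℕ) : ℝ) ≤ (F.scheme ℰp γ).β K := by
    rw [hβK, le_div_iff₀ hγ]
    push_cast
    have hsplit : (F.L : ℝ) ^ K = (F.L : ℝ) ^ j * (F.L : ℝ) ^ (K - j) := by rw [← pow_add]; congr 1; omega
    have h9 : (9 : ℝ) ≤ (F.L : ℝ) ^ (K - j) :=
      calc (9 : ℝ) = 3 ^ 2 := by norm_num
        _ ≤ (F.L : ℝ) ^ 2 := pow_le_pow_left₀ (by norm_num) hLr 2
        _ ≤ (F.L : ℝ) ^ (K - j) := pow_le_pow_right₀ (by linarith) (by omega)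
    rw [hsplit]
    nlinarith
  set x₀ : Site (F.P K) 0 := fun k => ((((a.src k).val * F.L ^ j : ℕ)) : ZMod ((F.P K).sitesPerDir 0)) - ((8 * F.L ^ j : ℕ) : ZMod ((F.P K).sitesPerDir 0)) with hx₀
  have hbox : ∀ U U' : GaugeField (F.P K) 0 (Matrix.specialUnitaryGroup (Fin 2) ℂ), (∀ b : PBond (F.P K) 0, (∀ k, (b.src k - x₀ k).val < 17 * F.L ^ j) →
      (∀ k, (b.tgt k - x₀ k).val < 17 * F.L ^ j) → U b = U' b) → g U = g U' := by
    intro U U' h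
    refine hgloc U U' fun b hb => h b (fun k => ?_) (fun k => ?_)
    · have hk : b.src k - x₀ k = b.src k - ((((a.src k).val * F.L ^ j : ℕ)) : ZMod ((F.P K).sitesPerDir 0)) + ((8 * F.L ^ j : ℕ) : ZMod ((F.P K).sitesPerDir 0)) := by
        simp only [hx₀]; ring
      rw [hk]; exact hb.1 k
    · have hk : b.tgt k - x₀ k = b.tgt k - ((((a.src k).val * F.L ^ j : ℕ)) : ZMod ((F.P K).sitesPerDir 0)) + ((8 * F.L ^ j : ℕ) : ZMod ((F.P K).sitesPerDir 0)) := by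
        simp only [hx₀]; ring
      rw [hk]; exact hb.2 k
  have hLipg : ∀ U U' : GaugeField (F.P K) 0 (Matrix.specialUnitaryGroup (Fin 2) ℂ), |g U - g U'| ≤
      Λ * Real.sqrt (∑ b : PBond (F.P K) 0, GaugeGroup.dist1 (U b * (U' b)⁻¹) ^ 2) :=
    fun U U' => (hgLip U U').trans (mul_le_mul_of_nonneg_left (boxLinkDist_le_linkDist _ U U') hΛpos.le)
  have hK := hK1 (17 * F.L ^ j) h1n hnβ h2n x₀ g Λ hΛpos hgmeas hginv hbox hLipg (θ / 4) (by positivity)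
  -- §5 exponent bookkeeping (p-LINEAR): `cc·√β_K·(θ/4)/(17L^j·Λ) = cc·p(g_{K−j})/(68(CL+1))` by `√β_K·θ(K−j) = √(L^j)·p(g_{K−j})`
  have hKsplit : K - j + j = K := Nat.sub_add_cancel (by omega)
  have hβLj : (F.scheme ℰp γ).β K = (F.L : ℝ) ^ j * (F.scheme ℰp γ).β (K - j) := by
    show (γ * (F.P K).eps)⁻¹ = (F.L : ℝ) ^ j * (γ * (F.P (K - j)).eps)⁻¹
    have he1 : (F.P K).eps = ((F.L : ℝ)⁻¹) ^ K := rfl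
    have he2 : (F.P (K - j)).eps = ((F.L : ℝ)⁻¹) ^ (K - j) := rfl
    have hL0 : (F.L : ℝ) ≠ 0 := by positivity
    rw [he1, he2]
    conv_lhs => rw [← hKsplit]
    rw [pow_add, inv_pow, inv_pow]
    field_simp
  set p : ℝ := B10.pFun b₀ p₀ (Real.sqrt (γ * ((F.L : ℝ)⁻¹) ^ (K - j))) with hp
  have hβθ : (F.scheme ℰp γ).β K * θ ^ 2 = (F.L : ℝ) ^ j * p ^ 2 := by
    rw [hβLj, mul_assoc, beta_mul_θBal_sq F hγ b₀ p₀ (K - j)]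
  have hβ0 : 0 ≤ (F.scheme ℰp γ).β K := F.scheme_β_nonneg ℰp hγ.le K
  -- `p > 0` from `θ = g·p > 0`, `g > 0`
  have hgK : 0 < Real.sqrt (γ * ((F.L : ℝ)⁻¹) ^ (K - j)) :=
    Real.sqrt_pos.mpr (mul_pos hγ (pow_pos (inv_pos.mpr (by positivity)) _))
  have hp0 : 0 < p := by
    by_contra hneg
    rw [not_lt] at hneg
    have : θ ≤ 0 := by
      rw [hθ]
      show Real.sqrt (γ * ((F.L : ℝ)⁻¹) ^ (K - j)) * B10.pFun b₀ p₀ (Real.sqrt (γ * ((F.L : ℝ)⁻¹) ^ (K - j))) ≤ 0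
      exact mul_nonpos_iff.mpr (Or.inl ⟨hgK.le, hneg⟩)
    linarith
  set s : ℝ := Real.sqrt ((F.L : ℝ) ^ j) with hs
  have hs2 : s ^ 2 = (F.L : ℝ) ^ j := Real.sq_sqrt hLj.le
  have hE : Real.sqrt ((F.scheme ℰp γ).β K) * θ = s * p := by
    have h1 : Real.sqrt ((F.scheme ℰp γ).β K) * θ = Real.sqrt ((F.scheme ℰp γ).β K * θ ^ 2) := by
      rw [Real.sqrt_mul hβ0, Real.sqrt_sq hθpos.le]
    have h2 : s * p = Real.sqrt ((F.L : ℝ) ^ j * p ^ 2) := by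
      rw [Real.sqrt_mul hLj.le, Real.sqrt_sq hp0.le]
    rw [h1, h2, hβθ]
  have hN : (((17 * F.L ^ j : ℕ)) : ℝ) = 17 * s ^ 2 := by push_cast; rw [hs2]
  have hexp : cc * Real.sqrt ((F.scheme ℰp γ).β K) * (θ / 4) / ((((17 * F.L ^ j : ℕ)) : ℝ) * Λ) =
      cc / (68 * (CL + 1)) * p := by
    have hCL1 : (CL + 1) ≠ 0 := by linarith
    have hs0 : s ≠ 0 := hsq.ne'
    have h1 : cc * Real.sqrt ((F.scheme ℰp γ).β K) * (θ / 4) = cc * (Real.sqrt ((F.scheme ℰp γ).β K) * θ) / 4 := by ring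
    rw [h1, hE, hN, hΛ]
    field_simp
    ring
  -- §6 conclude
  calc μ.real ({U : GaugeField (F.P K) 0 (Matrix.specialUnitaryGroup (Fin 2) ℂ) | θ ≤ f U} ∩ G)
      ≤ μ.real {U | θ / 4 ≤ g U - ∫ V, g V ∂μ} := measureReal_mono hsub (measure_ne_top _ _)
    _ ≤ Cc * Real.exp (-(cc * Real.sqrt ((F.scheme ℰp γ).β K) * (θ / 4) / ((((17 * F.L ^ j : ℕ)) : ℝ) * Λ))) := hK
    _ = Cc * Real.exp (-(cc / (68 * (CL + 1)) * p)) := by rw [hexp]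

end Summit.QuantumFields.YangMills.Theorems.PoincareLipschitzLinear
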